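import Summits.CriticalPhenomena.PercolationContinuityZ3.Theorems.PercNearOneGluingNoHeavyConstsLinearLowerTailGluedDust
import HarnessLib

/-!
# `Consts.LinearLowerTailThreeHalves` — the parts that are theorems (in the conjecture's own quantifier shape)

builds on p205010 (kernel theorem, internal audit signed; external expert review pending)

PAPER-2 track "percolation constants", part (ii), seat `prim-consts-1` (lane index `run/shared/lean/prim/consts/CONSTANTS.md`,
row A19).  Support file for the crux `NoHeavyLowerTail` (stmt-CriticalPhenomena-4575; `--supports … --as helper`): theorems only.

The conjecture (`…ConstsLinearLowerTailConjecture`, `Consts.LinearLowerTailThreeHalves`): for every `0 < κ ≤ 2/3`, every finite weighted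
graph, relay set `A`, observer `o` and `s ≥ max P(a ↮ a')`: `P(1 ≤ N < κ·EN) ≤ (3/2)·s`.  Proved parts, stated with exactly these
quantifiers plus the named restriction:
* `Consts.linearLowerTailThreeHalves_of_le_third` — the range `0 < κ ≤ 1/3` (all instances): there `1/(1−κ) ≤ 3/2`
  (`Consts.real_lowerTail_le_div`, `…ConstsNoHeavyRateHalf`).  So the open range of the conjecture is `(1/3, 2/3]`, of which only
  `(1/2, 2/3]` bears on the linear rate of the crux.
* `Consts.linearLowerTailThreeHalves_of_card_le` — every `0 < κ ≤ 2/3` and every instance with `o ∈ A` and `κ·|A| ≤ 3`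
  (`Consts.real_lowerTail_le_three_halves_of_card_le`, `…GluedDust`): all relay sets with `|A| ≤ 4`, and `|A| ≤ 6` for `κ ≤ 1/2`.
* (not restated) the clustered class of `…GluedGroups` / `…GluedDust`: `o ∈ A` and all but `(1−κ)|A|` relay points almost surely joined
  to two of them.
References: G. Kozma, N. Nitzan, arXiv:2401.12397 (2024), Conjecture 1 (p. 3); G. Grimmett, *Percolation* (1999), §1.3.
-/

noncomputable section

namespace Summit.CriticalPhenomena.PercolationContinuityZ3.Theorems

open MeasureTheory Set Literature.Probability.LatticeModels Literature.Probability.Percolation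
open scoped Classical

namespace Consts

/-- **(LT³⁄₂) on `0 < κ ≤ 1/3`**: there the reach-free bound `s/(1−κ)` is already `≤ (3/2)·s`. [cite: KozmaNitzan2024, Conj. 1 (p. 3)] -/
theorem linearLowerTailThreeHalves_of_le_third :
    ∀ κ : ℝ, 0 < κ → κ ≤ 1 / 3 →
      ∀ (n : ℕ) (w : Sym2 (Fin n) → unitInterval) (A : Finset (Fin n)) (o : Fin n) (s : ℝ), 0 ≤ s →
        (∀ a ∈ A, ∀ a' ∈ A, (prodBernoulli w).real (openConn a a')ᶜ ≤ s) →
        (prodBernoulli w).real {ω : BondConfig (Fin n) | 1 ≤ (A.filter fun a => ω ∈ openConn o a).card ∧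
            ((A.filter fun a => ω ∈ openConn o a).card : ℝ) < κ * (∑ a ∈ A, (prodBernoulli w).real (openConn o a))} ≤
          3 / 2 * s := by
  intro κ hκ0 hκ n w A o s hs hrel
  have hκ1 : κ < 1 := by linarith
  have h := real_lowerTail_le_div n w A o (ε := 1) hκ0 hκ1 one_pos hs hrel
  have hset : {ω : BondConfig (Fin n) | 1 ≤ (A.filter fun a => ω ∈ openConn o a).card ∧
      ((A.filter fun a => ω ∈ openConn o a).card : ℝ) <
        κ * 1 * (∑ a ∈ A, (prodBernoulli w).real (openConn o a)) / 1} =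
      {ω : BondConfig (Fin n) | 1 ≤ (A.filter fun a => ω ∈ openConn o a).card ∧
        ((A.filter fun a => ω ∈ openConn o a).card : ℝ) < κ * (∑ a ∈ A, (prodBernoulli w).real (openConn o a))} := by
    ext ω; simp only [mul_one, div_one, mem_setOf_eq]
  rw [hset] at h
  refine h.trans ?_
  have h1κ : 0 < 1 - κ := by linarith
  rw [div_le_iff₀ h1κ]
  nlinarith

/-- **(LT³⁄₂) for small relay sets**: every `0 < κ ≤ 2/3`, every instance with `o ∈ A` and `κ·|A| ≤ 3`.
[cite: KozmaNitzan2024, Conj. 1 (p. 3)] -/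
theorem linearLowerTailThreeHalves_of_card_le :
    ∀ κ : ℝ, 0 < κ → κ ≤ 2 / 3 →
      ∀ (n : ℕ) (w : Sym2 (Fin n) → unitInterval) (A : Finset (Fin n)) (o : Fin n) (s : ℝ), 0 ≤ s →
        o ∈ A → κ * A.card ≤ 3 →
        (∀ a ∈ A, ∀ a' ∈ A, (prodBernoulli w).real (openConn a a')ᶜ ≤ s) →
        (prodBernoulli w).real {ω : BondConfig (Fin n) | 1 ≤ (A.filter fun a => ω ∈ openConn o a).card ∧
            ((A.filter fun a => ω ∈ openConn o a).card : ℝ) < κ * (∑ a ∈ A, (prodBernoulli w).real (openConn o a))} ≤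
          3 / 2 * s := by
  intro κ _ hκ n w A o s _ ho hκA hrel
  exact real_lowerTail_le_three_halves_of_card_le n w A o ho (by linarith) hκA hrel

/-- **(LT³⁄₂) for at most three relay points, ANY observer**: every `κ < 1`... stated in the conjecture's shape for `0 < κ ≤ 2/3`:
if `|A| ≤ 3` then `P(1 ≤ N < κ·EN) ≤ (3/2)·s` (terminal cycle through the relay points themselves, `L = |A| ≤ 3`, no attachment defect).
[cite: KozmaNitzan2024, Conj. 1 (p. 3)] -/
theorem linearLowerTailThreeHalves_of_card_le_three :
    ∀ κ : ℝ, 0 < κ → κ ≤ 2 / 3 →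
      ∀ (n : ℕ) (w : Sym2 (Fin n) → unitInterval) (A : Finset (Fin n)) (o : Fin n) (s : ℝ), 0 ≤ s →
        A.card ≤ 3 →
        (∀ a ∈ A, ∀ a' ∈ A, (prodBernoulli w).real (openConn a a')ᶜ ≤ s) →
        (prodBernoulli w).real {ω : BondConfig (Fin n) | 1 ≤ (A.filter fun a => ω ∈ openConn o a).card ∧
            ((A.filter fun a => ω ∈ openConn o a).card : ℝ) < κ * (∑ a ∈ A, (prodBernoulli w).real (openConn o a))} ≤
          3 / 2 * s := by
  intro κ _ hκ n w A o s hs hA hrel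
  have hκ1 : κ < 1 := by linarith
  -- enumerate `A = {x, y, z}` allowing repetitions (pad with `x` when `|A| < 3`); empty `A`: the event is empty
  rcases A.eq_empty_or_nonempty with hAe | ⟨x, hx⟩
  · have hempty : {ω : BondConfig (Fin n) | 1 ≤ (A.filter fun a => ω ∈ openConn o a).card ∧
        ((A.filter fun a => ω ∈ openConn o a).card : ℝ) < κ * (∑ a ∈ A, (prodBernoulli w).real (openConn o a))} = ∅ := by
      ext ω; simp [hAe]
    rw [hempty, measureReal_empty]; positivity
  · -- list the elements: there are `y, z ∈ A` with `A ⊆ {x, y, z}`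
    obtain ⟨y, z, hy, hz, hcov⟩ : ∃ y z : Fin n, y ∈ A ∧ z ∈ A ∧ ∀ a ∈ A, a = x ∨ a = y ∨ a = z := by
      set B := A.erase x with hB
      have hBcard : B.card ≤ 2 := by rw [hB, Finset.card_erase_of_mem hx]; omega
      rcases B.eq_empty_or_nonempty with hBe | ⟨y, hyB⟩
      · refine ⟨x, x, hx, hx, fun a ha => Or.inl ?_⟩
        by_contra hax
        have : a ∈ B := Finset.mem_erase.2 ⟨hax, ha⟩
        rw [hBe] at this; exact Finset.notMem_empty a this
      · set C := B.erase y with hC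
        have hCcard : C.card ≤ 1 := by rw [hC, Finset.card_erase_of_mem hyB]; omega
        have hyA : y ∈ A := Finset.mem_of_mem_erase hyB
        rcases C.eq_empty_or_nonempty with hCe | ⟨z, hzC⟩
        · refine ⟨y, y, hyA, hyA, fun a ha => ?_⟩
          by_cases hax : a = x
          · exact Or.inl hax
          · by_cases hay : a = y
            · exact Or.inr (Or.inl hay)
            · have : a ∈ C := Finset.mem_erase.2 ⟨hay, Finset.mem_erase.2 ⟨hax, ha⟩⟩
              rw [hCe] at this; exact absurd this (Finset.notMem_empty a)
        · have hzA : z ∈ A := Finset.mem_of_mem_erase (Finset.mem_of_mem_erase hzC)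
          refine ⟨y, z, hyA, hzA, fun a ha => ?_⟩
          by_cases hax : a = x
          · exact Or.inl hax
          · by_cases hay : a = y
            · exact Or.inr (Or.inl hay)
            · have haC : a ∈ C := Finset.mem_erase.2 ⟨hay, Finset.mem_erase.2 ⟨hax, ha⟩⟩
              obtain ⟨c, hc⟩ := Finset.card_eq_one.1 (le_antisymm hCcard (Finset.card_pos.2 ⟨z, hzC⟩))
              have h1 : a = c := by rw [hc] at haC; exact Finset.mem_singleton.1 haC
              have h2 : z = c := by rw [hc] at hzC; exact Finset.mem_singleton.1 hzC
              exact Or.inr (Or.inr (h1.trans h2.symm))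
    set u : ℕ → Fin n := fun k => if k = 0 then x else if k = 1 then y else if k = 2 then z else x with hu
    set g : Fin n → ℕ := fun a => if a = x then 0 else if a = y then 1 else 2 with hg
    have huA : ∀ k, k < 3 → u k ∈ A := by
      intro k hk; interval_cases k <;> simp [hu, hx, hy, hz]
    have huL : u 3 = u 0 := by simp [hu]
    have hgL : ∀ a ∈ A, g a < 3 := by intro a _; simp only [hg]; split_ifs <;> norm_num
    have hη : ∑ a ∈ A, (prodBernoulli w).real (openConn (u (g a)) a)ᶜ = 0 := by
      refine Finset.sum_eq_zero fun a ha => ?_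
      have hua : u (g a) = a := by
        rcases hcov a ha with rfl | rfl | rfl
        · simp [hu, hg]
        · by_cases hax : a = x
          · simp [hu, hg, hax]
          · simp [hu, hg, hax]
        · by_cases hax : a = x
          · simp [hu, hg, hax]
          · by_cases hay : a = y
            · subst hay
              simp [hu, hg, hax]
            · simp [hu, hg, hax, hay]
      rw [hua]
      have : (openConn a a : Set (BondConfig (Fin n))) = univ := Set.eq_univ_of_forall fun ω => SimpleGraph.Reachable.refl _
      rw [this, Set.compl_univ, measureReal_empty]
    have h := real_lowerTail_le_half_cycle_add n w A o 3 u huA huL g hgL hκ1 hrel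
    rw [hη, add_zero] at h
    refine h.trans (le_of_eq ?_)
    norm_num

end Consts

end Summit.CriticalPhenomena.PercolationContinuityZ3.Theorems
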